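import Literature.Barriers.CriticalPhenomena.SupercriticalSAWSpaceFillingBoxesShift
import HarnessLib

/-!
# Supercritical self-avoiding walks are space-filling (Duminil-Copin–Kozma–Yadin 2014):
# merging two polygons across a rung gives a polygon, injectively

Third companion file of `SupercriticalSAWSpaceFillingBoxes.lean` towards the Claim in the
proof of Proposition 7 of H. Duminil-Copin, G. Kozma, A. Yadin, *Supercritical self-avoiding
walks are space-filling*, Ann. IHP Probab. Stat. 50 (2014) 315–326, arXiv:1110.3074, §3:
"by changing the edges `[cd]` and `[ab]` of `γ` and `γ'` into the edges `[ac]` and `[bd]`, one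
obtains a polygon in `S_F`. Furthermore, the construction is one-to-one". For the boxes with
moats the two new edges become two lattice paths of length `2g+1` (the rungs); given
`h : MergeData n g z i R₁ R₂ E₁ E₂` (`…BoxesRungs`):

* `exists_rungWalk` — the straight self-avoiding walk along a rung row and its edges;
* `MergeData.exists_cycle` — the merged edge set `mergeEdges n g z i (E₁ ∪ E₂)` is traced by
  the cycle "first lower rung edge, rest of the lower rung, `E₂` minus `[ab]`, upper rung
  backwards, `E₁` minus `[cd]`", of length `|E₁| + |E₂| + 4g` (the four pieces are
  self-avoiding and meet only at the junctions because `R₁`, `R₂` and the rung cells are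
  pairwise disjoint); hence `MergeData.isPolygon`, `MergeData.card`
  (`|merge| = |E₁| + |E₂| + 4g`) and `MergeData.subset` (the merge lives in
  `𝓔(R₁ ∪ R₂ ∪ rung cells)`);
* `MergeData.eq₁`, `MergeData.eq₂` — "the construction is one-to-one": `E₁` (resp. `E₂`) is
  the set of merged edges inside `𝓔(R₁)` (resp. `𝓔(R₂)`) plus its deleted cardinal edge.
-/

noncomputable section

open SimpleGraph Literature.Probability.LatticeModels Literature.Probability.Percolation
  Literature.Probability.RandomPlanarGeometry.SAW

namespace Literature.Barriers.CriticalPhenomena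

namespace SupercriticalSAW

/-- A straight lattice path along a rung row, from the rung point of index `k₀` to that of index
`K = k₀ + d`: self-avoiding, of length `d`, through the rung points of indices `k₀ ≤ j ≤ K`, with
the `d` rung edges in between. [cite: DuminilCopinKozmaYadin2014, §3 (proof of the Claim)] -/
theorem exists_rungWalk (n g : ℕ) (z : Site 2) (i : Fin 2) (t : Bool) :
    ∀ (d k₀ K : ℕ), K = k₀ + d →
      ∃ w : (zdGraph 2).Walk (rungPt n g z i k₀ t) (rungPt n g z i K t), w.IsPath ∧ w.length = d ∧
        (∀ v ∈ w.support, ∃ j, k₀ ≤ j ∧ j ≤ K ∧ v = rungPt n g z i j t) ∧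
        w.edges.toFinset =
          (Finset.Ico k₀ K).image fun j => s(rungPt n g z i j t, rungPt n g z i (j + 1) t) := by
  intro d
  induction d with
  | zero =>
    intro k₀ K hK
    obtain rfl : K = k₀ := by omega
    refine ⟨Walk.nil, Walk.IsPath.nil, rfl, fun v hv => ⟨K, le_rfl, le_rfl, ?_⟩, ?_⟩
    · simpa using hv
    · simp
  | succ d ih =>
    intro k₀ K hK
    obtain ⟨w, hw, hlen, hsupp, hedges⟩ := ih (k₀ + 1) K (by omega)
    refine ⟨Walk.cons (rungPt_adj_succ n g z i k₀ t) w, ?_, ?_, ?_, ?_⟩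
    · rw [Walk.cons_isPath_iff]
      refine ⟨hw, fun hmem => ?_⟩
      obtain ⟨j, hj, _, hj'⟩ := hsupp _ hmem
      have := (rungPt_inj hj').1
      omega
    · rw [Walk.length_cons, hlen]
    · intro v hv
      rw [Walk.support_cons, List.mem_cons] at hv
      rcases hv with rfl | hv
      · exact ⟨k₀, le_rfl, by omega, rfl⟩
      · obtain ⟨j, hj, hj', rfl⟩ := hsupp v hv
        exact ⟨j, by omega, hj', rfl⟩
    · rw [Walk.edges_cons, List.toFinset_cons, hedges]
      have : Finset.Ico k₀ K = insert k₀ (Finset.Ico (k₀ + 1) K) := by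
        ext j; simp only [Finset.mem_Ico, Finset.mem_insert]; omega
      rw [this, Finset.image_insert]

namespace MergeData

variable {n g : ℕ} {z : Site 2} {i : Fin 2} {R₁ R₂ : Finset (Site 2)}
  {E₁ E₂ : Finset (Sym2 (Site 2))}

/-- The endpoints of the removed cardinal edge of `B(z)` lie in `R₁`. [cite: DuminilCopinKozmaYadin2014, §3 (proof of the Claim)] -/
theorem rungPt_zero_mem (h : MergeData n g z i R₁ R₂ E₁ E₂) (t : Bool) :
    rungPt n g z i 0 t ∈ R₁ := by
  have h1 := mem_edgesIn_iff.1 (h.subset₁ h.mem₁)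
  rw [innerCardinalEdge_true_eq] at h1
  cases t
  · exact h1.2 _ (Sym2.mem_mk_left _ _)
  · exact h1.2 _ (Sym2.mem_mk_right _ _)

/-- The endpoints of the removed cardinal edge of `B(z + eᵢ)` lie in `R₂`. [cite: DuminilCopinKozmaYadin2014, §3 (proof of the Claim)] -/
theorem rungPt_last_mem (h : MergeData n g z i R₁ R₂ E₁ E₂) (t : Bool) :
    rungPt n g z i (2 * g + 1) t ∈ R₂ := by
  have h1 := mem_edgesIn_iff.1 (h.subset₂ h.mem₂)
  rw [innerCardinalEdge_false_eq] at h1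
  cases t
  · exact h1.2 _ (Sym2.mem_mk_left _ _)
  · exact h1.2 _ (Sym2.mem_mk_right _ _)

/-- No rung point of positive index lies in `R₁`. [cite: DuminilCopinKozmaYadin2014, §3 (proof of the Claim)] -/
theorem rungPt_notMem₁ (h : MergeData n g z i R₁ R₂ E₁ E₂) {k : ℕ} (hk : 1 ≤ k)
    (hk' : k ≤ 2 * g + 1) (t : Bool) : rungPt n g z i k t ∉ R₁ := by
  rcases eq_or_lt_of_le hk' with rfl | hlt
  · exact fun hmem => Finset.disjoint_left.1 h.disjoint hmem (h.rungPt_last_mem t)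
  · exact (h.rung_notMem k hk (by omega) t).1

/-- No rung point of index `≤ 2g` lies in `R₂`. [cite: DuminilCopinKozmaYadin2014, §3 (proof of the Claim)] -/
theorem rungPt_notMem₂ (h : MergeData n g z i R₁ R₂ E₁ E₂) {k : ℕ} (hk : k ≤ 2 * g) (t : Bool) :
    rungPt n g z i k t ∉ R₂ := by
  rcases Nat.eq_zero_or_pos k with rfl | hpos
  · exact fun hmem => Finset.disjoint_left.1 h.disjoint (h.rungPt_zero_mem t) hmem
  · exact (h.rung_notMem k hpos hk t).2

/-- The removed cardinal edge of `B(z)` is not an edge of `E₂`. [cite: DuminilCopinKozmaYadin2014, §3 (proof of the Claim)] -/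
theorem left_notMem₂ (h : MergeData n g z i R₁ R₂ E₁ E₂) : innerCardinalEdge n g z i true ∉ E₂ := by
  intro hmem
  have h1 := mem_edgesIn_iff.1 (h.subset₂ hmem)
  rw [innerCardinalEdge_true_eq] at h1
  exact h.rungPt_notMem₂ (Nat.zero_le _) false (h1.2 _ (Sym2.mem_mk_left _ _))

/-- The removed cardinal edge of `B(z + eᵢ)` is not an edge of `E₁`. [cite: DuminilCopinKozmaYadin2014, §3 (proof of the Claim)] -/
theorem right_notMem₁ (h : MergeData n g z i R₁ R₂ E₁ E₂) :
    innerCardinalEdge n g (z + Pi.single i 1) i false ∉ E₁ := by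
  intro hmem
  have h1 := mem_edgesIn_iff.1 (h.subset₁ hmem)
  rw [innerCardinalEdge_false_eq] at h1
  exact h.rungPt_notMem₁ (by omega) le_rfl false (h1.2 _ (Sym2.mem_mk_left _ _))

/-- **The merged edge set is traced by a cycle** (the heart of "one obtains a polygon in `S_F`"):
the lower rung from `B(z)` to `B(z + eᵢ)`, then `E₂` minus its cardinal edge, then the upper rung
backwards, then `E₁` minus its cardinal edge; its length is `|E₁| + |E₂| + 4g`.
[cite: DuminilCopinKozmaYadin2014, §3 (proof of the Claim)] -/
theorem exists_cycle (h : MergeData n g z i R₁ R₂ E₁ E₂) :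
    ∃ (u : Site 2) (c : (zdGraph 2).Walk u u), c.IsCycle ∧
      c.edges.toFinset = mergeEdges n g z i (E₁ ∪ E₂) ∧
      c.length + 2 = E₁.card + E₂.card + (4 * g + 2) := by
  classical
  -- `A₁`: `E₁` minus its cardinal edge, from the upper to the lower rung point of index `0`
  obtain ⟨u₁, c₁, hc₁, hcE₁⟩ := h.isPolygon₁
  have he₁ : s(rungPt n g z i 0 true, rungPt n g z i 0 false) ∈ c₁.edges := by
    rw [← List.mem_toFinset, hcE₁, Sym2.eq_swap, ← innerCardinalEdge_true_eq]; exact h.mem₁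
  obtain ⟨A₁, hA₁, -, hA₁E, hA₁len, hA₁supp⟩ := exists_isPath_of_isCycle_of_mem_edges hc₁ he₁
  have hc₁R : ∀ e ∈ c₁.edges, e ∈ edgesIn (zdGraph 2) R₁ := fun e he =>
    h.subset₁ (by rw [← hcE₁, List.mem_toFinset]; exact he)
  have hA₁R : ∀ v ∈ A₁.support, v ∈ R₁ := fun v hv =>
    support_subset_of_isCycle hc₁ hc₁R v (hA₁supp v hv)
  have hA₁sub : ∀ e ∈ A₁.edges, e ∈ edgesIn (zdGraph 2) R₁ := fun e he => by
    have h1 := List.mem_toFinset.2 he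
    rw [hA₁E] at h1
    exact hc₁R e (List.mem_toFinset.1 (Finset.mem_of_mem_erase h1))
  -- `A₂`: `E₂` minus its cardinal edge, from the lower to the upper rung point of index `2g+1`
  obtain ⟨u₂, c₂, hc₂, hcE₂⟩ := h.isPolygon₂
  have he₂ : s(rungPt n g z i (2 * g + 1) false, rungPt n g z i (2 * g + 1) true) ∈ c₂.edges := by
    rw [← List.mem_toFinset, hcE₂, ← innerCardinalEdge_false_eq]; exact h.mem₂
  obtain ⟨A₂, hA₂, -, hA₂E, hA₂len, hA₂supp⟩ := exists_isPath_of_isCycle_of_mem_edges hc₂ he₂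
  have hc₂R : ∀ e ∈ c₂.edges, e ∈ edgesIn (zdGraph 2) R₂ := fun e he =>
    h.subset₂ (by rw [← hcE₂, List.mem_toFinset]; exact he)
  have hA₂R : ∀ v ∈ A₂.support, v ∈ R₂ := fun v hv =>
    support_subset_of_isCycle hc₂ hc₂R v (hA₂supp v hv)
  have hA₂sub : ∀ e ∈ A₂.edges, e ∈ edgesIn (zdGraph 2) R₂ := fun e he => by
    have h1 := List.mem_toFinset.2 he
    rw [hA₂E] at h1
    exact hc₂R e (List.mem_toFinset.1 (Finset.mem_of_mem_erase h1))
  -- the two rungs: the lower one from index `1`, the upper one from index `0`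
  obtain ⟨RL, hRL, hRLlen, hRLsupp, hRLE⟩ :=
    exists_rungWalk n g z i false (2 * g) 1 (2 * g + 1) (by omega)
  obtain ⟨RU, hRU, hRUlen, hRUsupp, hRUE⟩ :=
    exists_rungWalk n g z i true (2 * g + 1) 0 (2 * g + 1) (by omega)
  -- `X₃`: the upper rung backwards, then `A₁`
  have hX₃ : (RU.reverse.append A₁).IsPath := by
    refine RectanglePair.isPath_append_of_inter hRU.reverse hA₁ fun v hv hv' => ?_
    rw [Walk.support_reverse, List.mem_reverse] at hv
    obtain ⟨j, -, hj, rfl⟩ := hRUsupp v hv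
    by_contra hne
    have hj0 : j ≠ 0 := fun h0 => hne (by rw [h0])
    exact h.rungPt_notMem₁ (Nat.pos_of_ne_zero hj0) hj true (hA₁R _ hv')
  have hX₃supp : ∀ v ∈ (RU.reverse.append A₁).support,
      (∃ j, j ≤ 2 * g + 1 ∧ v = rungPt n g z i j true) ∨ v ∈ R₁ := by
    intro v hv
    rw [Walk.mem_support_append_iff, Walk.support_reverse, List.mem_reverse] at hv
    rcases hv with hv | hv
    · obtain ⟨j, -, hj, rfl⟩ := hRUsupp v hv
      exact Or.inl ⟨j, hj, rfl⟩
    · exact Or.inr (hA₁R v hv)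
  -- `X₂`: `A₂`, then `X₃`
  have hX₂ : (A₂.append (RU.reverse.append A₁)).IsPath := by
    refine RectanglePair.isPath_append_of_inter hA₂ hX₃ fun v hv hv' => ?_
    have hvR := hA₂R v hv
    rcases hX₃supp v hv' with ⟨j, hj, rfl⟩ | hv₁
    · by_contra hne
      have hj' : j ≠ 2 * g + 1 := fun h' => hne (by rw [h'])
      exact h.rungPt_notMem₂ (by omega) true hvR
    · exact absurd hvR (Finset.disjoint_left.1 h.disjoint hv₁)
  have hX₂supp : ∀ v ∈ (A₂.append (RU.reverse.append A₁)).support,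
      v ∈ R₂ ∨ (∃ j, j ≤ 2 * g + 1 ∧ v = rungPt n g z i j true) ∨ v ∈ R₁ := by
    intro v hv
    rw [Walk.mem_support_append_iff] at hv
    rcases hv with hv | hv
    · exact Or.inl (hA₂R v hv)
    · exact Or.inr (hX₃supp v hv)
  -- `W`: the lower rung from index `1`, then `X₂`
  have hW : (RL.append (A₂.append (RU.reverse.append A₁))).IsPath := by
    refine RectanglePair.isPath_append_of_inter hRL hX₂ fun v hv hv' => ?_
    obtain ⟨j, hj1, hj2, rfl⟩ := hRLsupp v hv
    rcases hX₂supp _ hv' with hvR | ⟨j', -, hjj'⟩ | hvR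
    · by_contra hne
      have : j ≠ 2 * g + 1 := fun h' => hne (by rw [h'])
      exact h.rungPt_notMem₂ (by omega) false hvR
    · exact absurd (rungPt_inj hjj').2 Bool.false_ne_true
    · exact absurd hvR (h.rungPt_notMem₁ hj1 hj2 false)
  -- the cycle: the first lower rung edge, then `W`
  refine ⟨rungPt n g z i 0 false,
    Walk.cons (rungPt_adj_succ n g z i 0 false) (RL.append (A₂.append (RU.reverse.append A₁))),
    ?_, ?_, ?_⟩
  · rw [Walk.cons_isCycle_iff]
    refine ⟨hW, fun hmem => ?_⟩
    simp only [Walk.edges_append, Walk.edges_reverse, List.mem_append, List.mem_reverse] at hmem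
    rcases hmem with hmem | hmem | hmem | hmem
    · obtain ⟨j, hj, -, hj'⟩ := hRLsupp _ (RL.fst_mem_support_of_mem_edges hmem)
      have := (rungPt_inj hj').1
      omega
    · exact h.rungPt_notMem₂ (Nat.zero_le _) false
        ((mem_edgesIn_iff.1 (hA₂sub _ hmem)).2 _ (Sym2.mem_mk_left _ _))
    · obtain ⟨j, -, -, hj'⟩ := hRUsupp _ (RU.fst_mem_support_of_mem_edges hmem)
      exact absurd (rungPt_inj hj').2 Bool.false_ne_true
    · exact h.rungPt_notMem₁ le_rfl (by omega) false
        ((mem_edgesIn_iff.1 (hA₁sub _ hmem)).2 _ (Sym2.mem_mk_right _ _))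
  · -- the edge set
    have hsd : (E₁ ∪ E₂) \ {innerCardinalEdge n g z i true,
        innerCardinalEdge n g (z + Pi.single i 1) i false} =
        E₁.erase (innerCardinalEdge n g z i true) ∪
          E₂.erase (innerCardinalEdge n g (z + Pi.single i 1) i false) := by
      ext e
      simp only [Finset.mem_sdiff, Finset.mem_union, Finset.mem_insert, Finset.mem_singleton,
        Finset.mem_erase]
      constructor
      · rintro ⟨h1 | h1, h2⟩
        · exact Or.inl ⟨fun h3 => h2 (Or.inl h3), h1⟩
        · exact Or.inr ⟨fun h3 => h2 (Or.inr h3), h1⟩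
      · rintro (⟨h1, h2⟩ | ⟨h1, h2⟩)
        · refine ⟨Or.inl h2, ?_⟩
          rintro (h3 | h3)
          · exact h1 h3
          · exact h.right_notMem₁ (h3 ▸ h2)
        · refine ⟨Or.inr h2, ?_⟩
          rintro (h3 | h3)
          · exact h.left_notMem₂ (h3 ▸ h2)
          · exact h1 h3
    have hIco : insert s(rungPt n g z i 0 false, rungPt n g z i (0 + 1) false)
        ((Finset.Ico 1 (2 * g + 1)).image fun j =>
          s(rungPt n g z i j false, rungPt n g z i (j + 1) false)) =
        (Finset.range (2 * g + 1)).image fun j =>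
          s(rungPt n g z i j false, rungPt n g z i (j + 1) false) := by
      rw [← Finset.image_insert (fun j => s(rungPt n g z i j false, rungPt n g z i (j + 1) false)) 0
        (Finset.Ico 1 (2 * g + 1))]
      congr 1
      ext j; simp only [Finset.mem_insert, Finset.mem_Ico, Finset.mem_range]; omega
    rw [Walk.edges_cons, List.toFinset_cons]
    simp only [Walk.edges_append, Walk.edges_reverse, List.toFinset_append, List.toFinset_reverse,
      hRLE, hRUE, hA₁E, hA₂E, hcE₁, hcE₂]
    rw [mergeEdges, hsd, rungEdges, Finset.range_eq_Ico, ← Finset.insert_union, hIco,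
      Finset.range_eq_Ico, Sym2.eq_swap (a := rungPt n g z i 0 true), ← innerCardinalEdge_true_eq,
      ← innerCardinalEdge_false_eq]
    simp only [Finset.union_assoc, Finset.union_comm, Finset.union_left_comm]
  · -- the length
    have hcard₁ : E₁.card = c₁.length := by
      rw [← hcE₁, List.toFinset_card_of_nodup hc₁.isCircuit.isTrail.edges_nodup, Walk.length_edges]
    have hcard₂ : E₂.card = c₂.length := by
      rw [← hcE₂, List.toFinset_card_of_nodup hc₂.isCircuit.isTrail.edges_nodup, Walk.length_edges]
    simp only [Walk.length_cons, Walk.length_append, Walk.length_reverse, hRLlen, hRUlen]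
    omega

end MergeData

namespace MergeData

variable {n g : ℕ} {z : Site 2} {i : Fin 2} {R₁ R₂ : Finset (Site 2)}
  {E₁ E₂ : Finset (Sym2 (Site 2))}

/-- **The merge is a polygon.** [cite: DuminilCopinKozmaYadin2014, §3 (proof of the Claim: "one obtains a polygon in S_F")] -/
theorem isPolygon (h : MergeData n g z i R₁ R₂ E₁ E₂) :
    IsPolygon (zdGraph 2) (mergeEdges n g z i (E₁ ∪ E₂)) := by
  obtain ⟨u, c, hc, hE, -⟩ := h.exists_cycle
  exact ⟨u, c, hc, hE⟩

/-- **The merge has `|E₁| + |E₂| + 4g` edges** (two rungs of `2g+1` edges replace two edges).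
[cite: DuminilCopinKozmaYadin2014, §3 (proof of the Claim)] -/
theorem card (h : MergeData n g z i R₁ R₂ E₁ E₂) :
    (mergeEdges n g z i (E₁ ∪ E₂)).card = E₁.card + E₂.card + 4 * g := by
  obtain ⟨u, c, hc, hE, hlen⟩ := h.exists_cycle
  rw [← hE, List.toFinset_card_of_nodup hc.isCircuit.isTrail.edges_nodup, Walk.length_edges]
  omega

/-- Every rung point of index `≤ 2g+1` lies in `R₁ ∪ R₂ ∪ rungCells`. [cite: DuminilCopinKozmaYadin2014, §3 (proof of the Claim)] -/
theorem rungPt_mem_union (h : MergeData n g z i R₁ R₂ E₁ E₂) {k : ℕ} (hk : k ≤ 2 * g + 1)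
    (t : Bool) : rungPt n g z i k t ∈ R₁ ∪ R₂ ∪ rungCells n g z i := by
  rcases Nat.eq_zero_or_pos k with rfl | hpos
  · exact Finset.mem_union_left _ (Finset.mem_union_left _ (h.rungPt_zero_mem t))
  rcases eq_or_lt_of_le hk with rfl | hlt
  · exact Finset.mem_union_left _ (Finset.mem_union_right _ (h.rungPt_last_mem t))
  · exact Finset.mem_union_right _ (mem_rungCells_iff.2 ⟨k, hpos, by omega, t, rfl⟩)

/-- **The merge lives in `R₁ ∪ R₂ ∪ rungCells`.** [cite: DuminilCopinKozmaYadin2014, §3 (proof of the Claim)] -/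
theorem subset (h : MergeData n g z i R₁ R₂ E₁ E₂) :
    mergeEdges n g z i (E₁ ∪ E₂) ⊆ edgesIn (zdGraph 2) (R₁ ∪ R₂ ∪ rungCells n g z i) := by
  intro e he
  rw [mergeEdges, Finset.mem_union, Finset.mem_sdiff, Finset.mem_union] at he
  rcases he with ⟨he | he, -⟩ | he
  · exact edgesIn_subset_of_subset
      (Finset.subset_union_left.trans Finset.subset_union_left) (h.subset₁ he)
  · exact edgesIn_subset_of_subset
      (Finset.subset_union_right.trans Finset.subset_union_left) (h.subset₂ he)
  · obtain ⟨k, hk, t, rfl⟩ := mem_rungEdges_iff.1 he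
    rw [mem_edgesIn_iff]
    refine ⟨rungPt_adj_succ n g z i k t, fun x hx => ?_⟩
    rcases Sym2.mem_iff.1 hx with rfl | rfl
    · exact h.rungPt_mem_union (by omega) t
    · exact h.rungPt_mem_union (by omega) t

/-- An edge with all its endpoints in `R₁` and in `R₂` contradicts their disjointness. [folklore] -/
theorem not_mem_edgesIn_both (h : MergeData n g z i R₁ R₂ E₁ E₂) {e : Sym2 (Site 2)}
    (h₁ : e ∈ edgesIn (zdGraph 2) R₁) (h₂ : e ∈ edgesIn (zdGraph 2) R₂) : False := by
  induction e using Sym2.ind with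
  | _ a b =>
    exact Finset.disjoint_left.1 h.disjoint ((mem_edgesIn_iff.1 h₁).2 a (Sym2.mem_mk_left a b))
      ((mem_edgesIn_iff.1 h₂).2 a (Sym2.mem_mk_left a b))

/-- **`E₁` is recovered from the merge**: it is the set of merged edges with both endpoints in
`R₁`, plus the removed cardinal edge ("the construction is one-to-one").
[cite: DuminilCopinKozmaYadin2014, §3 (proof of the Claim)] -/
theorem eq₁ (h : MergeData n g z i R₁ R₂ E₁ E₂) :
    E₁ = insert (innerCardinalEdge n g z i true)
      ((mergeEdges n g z i (E₁ ∪ E₂)).filter fun e => e ∈ edgesIn (zdGraph 2) R₁) := by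
  ext e
  rw [Finset.mem_insert, Finset.mem_filter, mergeEdges, Finset.mem_union, Finset.mem_sdiff,
    Finset.mem_union, Finset.mem_insert, Finset.mem_singleton]
  constructor
  · intro he
    by_cases hel : e = innerCardinalEdge n g z i true
    · exact Or.inl hel
    · refine Or.inr ⟨Or.inl ⟨Or.inl he, ?_⟩, h.subset₁ he⟩
      rintro (h1 | h1)
      · exact hel h1
      · exact h.right_notMem₁ (h1 ▸ he)
  · rintro (rfl | ⟨(⟨he | he, -⟩ | he), hR⟩)
    · exact h.mem₁
    · exact he
    · exact (h.not_mem_edgesIn_both hR (h.subset₂ he)).elim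
    · obtain ⟨k, hk, t, rfl⟩ := mem_rungEdges_iff.1 he
      exact (h.rungPt_notMem₁ (by omega) (by omega) t
        ((mem_edgesIn_iff.1 hR).2 _ (Sym2.mem_mk_right _ _))).elim

/-- **`E₂` is recovered from the merge** likewise. [cite: DuminilCopinKozmaYadin2014, §3 (proof of the Claim)] -/
theorem eq₂ (h : MergeData n g z i R₁ R₂ E₁ E₂) :
    E₂ = insert (innerCardinalEdge n g (z + Pi.single i 1) i false)
      ((mergeEdges n g z i (E₁ ∪ E₂)).filter fun e => e ∈ edgesIn (zdGraph 2) R₂) := by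
  ext e
  rw [Finset.mem_insert, Finset.mem_filter, mergeEdges, Finset.mem_union, Finset.mem_sdiff,
    Finset.mem_union, Finset.mem_insert, Finset.mem_singleton]
  constructor
  · intro he
    by_cases her : e = innerCardinalEdge n g (z + Pi.single i 1) i false
    · exact Or.inl her
    · refine Or.inr ⟨Or.inl ⟨Or.inr he, ?_⟩, h.subset₂ he⟩
      rintro (h1 | h1)
      · exact h.left_notMem₂ (h1 ▸ he)
      · exact her h1
  · rintro (rfl | ⟨(⟨he | he, -⟩ | he), hR⟩)
    · exact h.mem₂
    · exact (h.not_mem_edgesIn_both (h.subset₁ he) hR).elim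
    · exact he
    · obtain ⟨k, hk, t, rfl⟩ := mem_rungEdges_iff.1 he
      exact (h.rungPt_notMem₂ (by omega) t
        ((mem_edgesIn_iff.1 hR).2 _ (Sym2.mem_mk_left _ _))).elim

end MergeData


end SupercriticalSAW

end Literature.Barriers.CriticalPhenomena
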